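import Mathlib
import Literature.Analysis.FluidPDE.VectorCalculus
import Literature.Analysis.FluidPDE.LocalTypeI
import Summits.NavierStokesRegularity.NavierStokesRegularity.Theorems.RootDecompLitSliceDarkBallSpreadsComplConnected
import Summits.NavierStokesRegularity.NavierStokesRegularity.Theorems.RootDecompLitSliceDarkBallSpreadsRegularPointSmoothing
import Summits.NavierStokesRegularity.NavierStokesRegularity.Theorems.RootDecompLitSliceDarkBallSpreadsTerminalLimit
import HarnessLib

/-!
# Route RootDecompLitSlice — brick B1′ «TERMINAL LIMIT FIELD» of the aside D₁ `DarkBallSpreads`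
  (stmt-NavierStokesRegularity-29566, the registered stub `stub_darkBallSpreads` of crux D `NoDarkBall`
  stmt-NavierStokesRegularity-29563), part 2/2: **the terminal field of a Clay-class solution on its
  regular terminal slice**

Part 1 (`Theorems/RootDecompLitSliceDarkBallSpreadsTerminalLimit.lean`) proved: space–time Hölder
bounds for all spatial derivatives on `(a, b) × U` make any pointwise limit as `s → b⁻` smooth on `U`,
with uniform convergence of every derivative. Here:

* §3 (patching): if every point of a set `S` carries a cylinder `(T − r², T) × B(x₀, r)` with smooth
  slices and space–time Hölder derivatives, the GLOBAL pointwise limit `w y := limUnder (𝓝[<] T) (u · y)`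
  is `C^∞` on `S` with `u t → w` and `fderiv (u t) → fderiv w` LOCALLY UNIFORMLY on `S`
  (`terminalField_of_local_holder_cylinders`; the patched pieces agree because limits are unique);
* §4: the divergence passes to the limit (`divergence_eq_zero_of_tendsto_fderiv`: the divergence is the
  trace of `fderiv`, continuous in finite dimension) and the restatement on
  `S = Σ_Tᶜ = {x | IsBackwardSingularPoint u (T, x)}ᶜ` with the cylinders written
  `parabolicCylinder r (T, x₀)` (`terminalField_on_compl_backwardSingularSlice`);
* §5 THE BRICK `terminalField_of_classical_lerayHopf`: for `ν, T > 0`, `(u, p)` classical on `[0, T)`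
  and Leray–Hopf on `[0, T]` from a rapidly decaying datum (D₁'s binders, maximality projected), brick
  B1 (`regularPoint_iteratedFDeriv_bounds`, census p803792) supplies the cylinders, the joint smoothness
  the slices (`IsClassicalNSSolutionOn.contDiff_velocity`), `divFree` the divergence: hence a terminal
  field `w ∈ C^∞(Σ_Tᶜ)` with `u t → w`, `∇u t → ∇w` locally uniformly on `Σ_Tᶜ`, pointwise at every
  regular point, and `div w = 0` on `Σ_Tᶜ` — the `∃ w`-clause of `H_B1B3B4` except `curl w = 0 on Σ_Tᶜ`,
  which is PROPAGATION (`curl_eq_zero_compl_backwardSingularSlice_of_darkBall`) + the local spread step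
  (B3/B4, census). Combine with `lerayHopf_ae_eq_restrict_of_tendstoLocallyUniformlyOn` (B2) and the
  B6″ tail.

HONEST FRAMING: bookkeeping about a HYPOTHETICAL singular time; closes no item; decorative for the
summit per D-0179; nothing here bears on NS regularity (rung 0). Lands
`--supports stmt-NavierStokesRegularity-29566 --as helper` (decomp-ns route-writer g16). [folklore]
-/

noncomputable section

open MeasureTheory Set Function Filter Topology Metric
open scoped ENNReal NNReal ContDiff
open Literature.Analysis.FluidPDE

-- the summit and its single sub-problem share the name (CONVENTIONS §1), as in every Theorems file
set_option linter.dupNamespace false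

namespace Summit.NavierStokesRegularity.NavierStokesRegularity.Theorems

/-! ## §3 Patching local cylinders: the global terminal field -/

section Patching

variable {E : Type*} [NormedAddCommGroup E] [NormedSpace ℝ E]
  {G : Type*} [NormedAddCommGroup G] [NormedSpace ℝ G] [CompleteSpace G]

/-- **The global terminal field.** Let `u : ℝ → E → G` and `S ⊆ E`. Suppose every `x₀ ∈ S` carries a
backward cylinder `(T − r², T) × B(x₀, r)`, `r > 0`, on which the slices are smooth and every spatial
derivative `iteratedFDeriv ℝ n (u t)` is space–time Hölder (exponent `> 0`). Then the pointwise
terminal limit `w y := limUnder (𝓝[<] T) (u · y)` satisfies: `u t y → w y` for `y ∈ S`; `w` is `C^∞`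
on `S`; `u t → w` and `fderiv (u t) → fderiv w` LOCALLY UNIFORMLY on `S` as `t → T⁻`. (Uniform Cauchy
in `t` on each ball + patching; the patched pieces agree because limits are unique.) [folklore] -/
theorem terminalField_of_local_holder_cylinders (u : ℝ → E → G) (T : ℝ) (S : Set E)
    (hcyl : ∀ x₀ ∈ S, ∃ r > 0,
      (∀ z ∈ Ioo (T - r ^ 2) T ×ˢ ball x₀ r, ContDiffAt ℝ ∞ (u z.1) z.2) ∧
      ∀ n : ℕ, ∃ C α : ℝ≥0, 0 < α ∧
        HolderOnWith C α (fun z : ℝ × E => iteratedFDeriv ℝ n (u z.1) z.2)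
          (Ioo (T - r ^ 2) T ×ˢ ball x₀ r)) :
    (∀ y ∈ S, Tendsto (fun t => u t y) (𝓝[<] T)
        (𝓝 ((fun y => limUnder (𝓝[<] T) fun t => u t y) y))) ∧
    ContDiffOn ℝ ∞ (fun y => limUnder (𝓝[<] T) fun t => u t y) S ∧
    TendstoLocallyUniformlyOn u (fun y => limUnder (𝓝[<] T) fun t => u t y) (𝓝[<] T) S ∧
    TendstoLocallyUniformlyOn (fun t => fderiv ℝ (u t))
      (fderiv ℝ (fun y => limUnder (𝓝[<] T) fun t => u t y)) (𝓝[<] T) S := by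
  set w : E → G := fun y => limUnder (𝓝[<] T) fun t => u t y with hw_def
  -- on each cylinder's ball: pointwise convergence to `w`
  have hball : ∀ x₀ ∈ S, ∃ r > 0,
      (∀ z ∈ Ioo (T - r ^ 2) T ×ˢ ball x₀ r, ContDiffAt ℝ ∞ (u z.1) z.2) ∧
      (∀ n : ℕ, ∃ C α : ℝ≥0, 0 < α ∧
        HolderOnWith C α (fun z : ℝ × E => iteratedFDeriv ℝ n (u z.1) z.2)
          (Ioo (T - r ^ 2) T ×ˢ ball x₀ r)) ∧
      (T - r ^ 2 < T) ∧
      ∀ y ∈ ball x₀ r, Tendsto (fun t => u t y) (𝓝[<] T) (𝓝 (w y)) := by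
    intro x₀ hx₀
    obtain ⟨r, hr, hS, hH⟩ := hcyl x₀ hx₀
    have hab : T - r ^ 2 < T := by nlinarith
    refine ⟨r, hr, hS, hH, hab, fun y hy => ?_⟩
    obtain ⟨C, α, hα, hF⟩ := hH 0
    exact tendsto_nhds_limUnder (exists_tendsto_of_holderOnWith_iteratedFDeriv_zero hab hα hF hy)
  refine ⟨?_, ?_, ?_, ?_⟩
  · intro y hy
    obtain ⟨r, hr, -, -, -, hlim⟩ := hball y hy
    exact hlim y (mem_ball_self hr)
  · refine contDiffOn_of_locally_contDiffOn fun x₀ hx₀ => ?_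
    obtain ⟨r, hr, hS, hH, hab, hlim⟩ := hball x₀ hx₀
    exact ⟨ball x₀ r, isOpen_ball, mem_ball_self hr,
      (contDiffOn_of_tendsto_of_holderOnWith_iteratedFDeriv hab isOpen_ball
        (fun s hs y hy => hS (s, y) (mk_mem_prod hs hy)) hH hlim).mono inter_subset_right⟩
  · intro V hV x₀ hx₀
    obtain ⟨r, hr, hS, hH, hab, hlim⟩ := hball x₀ hx₀
    exact ⟨ball x₀ r, mem_nhdsWithin_of_mem_nhds (ball_mem_nhds x₀ hr),
      tendstoUniformlyOn_of_tendsto_of_holderOnWith_iteratedFDeriv hab isOpen_ball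
        (fun s hs y hy => hS (s, y) (mk_mem_prod hs hy)) hH hlim V hV⟩
  · intro V hV x₀ hx₀
    obtain ⟨r, hr, hS, hH, hab, hlim⟩ := hball x₀ hx₀
    exact ⟨ball x₀ r, mem_nhdsWithin_of_mem_nhds (ball_mem_nhds x₀ hr),
      tendstoUniformlyOn_fderiv_of_tendsto_of_holderOnWith_iteratedFDeriv hab isOpen_ball
        (fun s hs y hy => hS (s, y) (mk_mem_prod hs hy)) hH hlim V hV⟩

end Patching

/-! ## §4 Divergence passes to the limit; the D₁-facing restatement -/

section Slice

/-- **A pointwise limit of divergence-free fields with converging gradients is divergence free** at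
the point (the divergence is the trace of `fderiv`, a continuous linear functional in finite
dimension). [folklore] -/
theorem divergence_eq_zero_of_tendsto_fderiv {ι : Type*} {l : Filter ι} [l.NeBot]
    {v : ι → EuclideanSpace ℝ (Fin 3) → EuclideanSpace ℝ (Fin 3)}
    {w : EuclideanSpace ℝ (Fin 3) → EuclideanSpace ℝ (Fin 3)} {y : EuclideanSpace ℝ (Fin 3)}
    (hconv : Tendsto (fun i => fderiv ℝ (v i) y) l (𝓝 (fderiv ℝ w y)))
    (hdiv : ∀ᶠ i in l, VectorCalculus.divergence (v i) y = 0) :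
    VectorCalculus.divergence w y = 0 := by
  -- the divergence as a continuous function of the derivative
  let τ : (EuclideanSpace ℝ (Fin 3) →L[ℝ] EuclideanSpace ℝ (Fin 3)) →ₗ[ℝ] ℝ :=
    (LinearMap.trace ℝ (EuclideanSpace ℝ (Fin 3))).comp
      (ContinuousLinearMap.coeLM ℝ :
        (EuclideanSpace ℝ (Fin 3) →L[ℝ] EuclideanSpace ℝ (Fin 3)) →ₗ[ℝ]
          (EuclideanSpace ℝ (Fin 3) →ₗ[ℝ] EuclideanSpace ℝ (Fin 3)))
  have hτ : Continuous τ := τ.continuous_of_finiteDimensional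
  have hτdiv : ∀ f : EuclideanSpace ℝ (Fin 3) → EuclideanSpace ℝ (Fin 3),
      VectorCalculus.divergence f y = τ (fderiv ℝ f y) := fun f => rfl
  have h1 : Tendsto (fun i => VectorCalculus.divergence (v i) y) l
      (𝓝 (VectorCalculus.divergence w y)) := by
    simp only [hτdiv]
    exact (hτ.tendsto _).comp hconv
  have h2 : Tendsto (fun i => VectorCalculus.divergence (v i) y) l (𝓝 0) :=
    tendsto_const_nhds.congr' (hdiv.mono fun i hi => hi.symm)
  exact tendsto_nhds_unique h1 h2

/-- **Brick B1′ for D₁, restated on the regular terminal slice.** Let `u : ℝ → ℝ³ → ℝ³`, `T : ℝ`, and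
`Σ_T = {x | IsBackwardSingularPoint u (T, x)}`. Suppose (brick B1) every `x₀ ∈ Σ_Tᶜ` has a backward
cylinder `parabolicCylinder r (T, x₀)`, `r > 0`, on which the slices are smooth and every spatial
derivative is space–time Hölder. Then the terminal field `w y := limUnder (𝓝[<] T) (u · y)` is `C^∞`
on `Σ_Tᶜ`, `u t → w` and `fderiv (u t) → fderiv w` locally uniformly on `Σ_Tᶜ` as `t → T⁻`, with
pointwise convergence at every regular point; and if the slices `u t`, `t < T` near `T`, are
divergence free then so is `w` on `Σ_Tᶜ`. (This is the `∃ w`-clause of the interface `H_B1B3B4`;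
combine with `lerayHopf_ae_eq_restrict_of_tendstoLocallyUniformlyOn` (B2) and
`curl_eq_zero_compl_backwardSingularSlice_of_darkBall` (PROPAGATION).) [folklore] -/
theorem terminalField_on_compl_backwardSingularSlice
    (u : ℝ → EuclideanSpace ℝ (Fin 3) → EuclideanSpace ℝ (Fin 3)) (T : ℝ)
    (hcyl : ∀ x₀ ∈ {x : EuclideanSpace ℝ (Fin 3) | IsBackwardSingularPoint u (T, x)}ᶜ, ∃ r > 0,
      (∀ z ∈ parabolicCylinder r ((T : ℝ), x₀), ContDiffAt ℝ ∞ (u z.1) z.2) ∧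
      ∀ n : ℕ, ∃ C α : ℝ≥0, 0 < α ∧
        HolderOnWith C α (fun z : ℝ × EuclideanSpace ℝ (Fin 3) => iteratedFDeriv ℝ n (u z.1) z.2)
          (parabolicCylinder r ((T : ℝ), x₀)))
    (hdiv : ∀ᶠ t in 𝓝[<] T, ∀ y, VectorCalculus.divergence (u t) y = 0) :
    ∃ w : EuclideanSpace ℝ (Fin 3) → EuclideanSpace ℝ (Fin 3),
      (∀ y ∈ {x : EuclideanSpace ℝ (Fin 3) | IsBackwardSingularPoint u (T, x)}ᶜ,
        Tendsto (fun t => u t y) (𝓝[<] T) (𝓝 (w y))) ∧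
      ContDiffOn ℝ ∞ w {x : EuclideanSpace ℝ (Fin 3) | IsBackwardSingularPoint u (T, x)}ᶜ ∧
      TendstoLocallyUniformlyOn u w (𝓝[<] T)
        {x : EuclideanSpace ℝ (Fin 3) | IsBackwardSingularPoint u (T, x)}ᶜ ∧
      TendstoLocallyUniformlyOn (fun t => fderiv ℝ (u t)) (fderiv ℝ w) (𝓝[<] T)
        {x : EuclideanSpace ℝ (Fin 3) | IsBackwardSingularPoint u (T, x)}ᶜ ∧
      ∀ y ∈ {x : EuclideanSpace ℝ (Fin 3) | IsBackwardSingularPoint u (T, x)}ᶜ,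
        VectorCalculus.divergence w y = 0 := by
  have hcyl' : ∀ x₀ ∈ {x : EuclideanSpace ℝ (Fin 3) | IsBackwardSingularPoint u (T, x)}ᶜ, ∃ r > 0,
      (∀ z ∈ Ioo (T - r ^ 2) T ×ˢ ball x₀ r, ContDiffAt ℝ ∞ (u z.1) z.2) ∧
      ∀ n : ℕ, ∃ C α : ℝ≥0, 0 < α ∧
        HolderOnWith C α (fun z : ℝ × EuclideanSpace ℝ (Fin 3) => iteratedFDeriv ℝ n (u z.1) z.2)
          (Ioo (T - r ^ 2) T ×ˢ ball x₀ r) := by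
    intro x₀ hx₀
    obtain ⟨r, hr, hS, hH⟩ := hcyl x₀ hx₀
    exact ⟨r, hr, by simpa [parabolicCylinder] using hS, by simpa [parabolicCylinder] using hH⟩
  obtain ⟨hpt, hCD, hloc, hloc1⟩ := terminalField_of_local_holder_cylinders u T _ hcyl'
  refine ⟨fun y => limUnder (𝓝[<] T) fun t => u t y, hpt, hCD, hloc, hloc1, fun y hy => ?_⟩
  haveI : (𝓝[<] T).NeBot := inferInstance
  have h1 : Tendsto (fun t => fderiv ℝ (u t) y) (𝓝[<] T)
      (𝓝 (fderiv ℝ (fun y => limUnder (𝓝[<] T) fun t => u t y) y)) :=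
    hloc1.tendsto_at hy
  exact divergence_eq_zero_of_tendsto_fderiv h1 (hdiv.mono fun t ht => ht y)

/-- **Brick B1′ (the terminal field of a Clay-class solution on its regular terminal slice).** Let
`ν, T > 0`, `(u, p)` classical on `ℝ³ × [0, T)` and Leray–Hopf on `[0, T]` from a rapidly decaying datum
(D₁'s binders, maximality projected by `IsMaximalSmoothSolution.isClassicalNSSolutionOn`). Then there is
a field `w`, `C^∞` on the regular set `Σ_Tᶜ = {x | IsBackwardSingularPoint u (T, x)}ᶜ`, with
`u t y → w y` at every regular `y`, `u t → w` and `fderiv (u t) → fderiv w` locally uniformly on `Σ_Tᶜ`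
as `t → T⁻`, and `div w = 0` on `Σ_Tᶜ`. The cylinders come from brick B1
(`regularPoint_iteratedFDeriv_bounds`), the rest is §3. [folklore] -/
theorem terminalField_of_classical_lerayHopf {ν T : ℝ} (hν : 0 < ν) (hT : 0 < T)
    {u : ℝ → EuclideanSpace ℝ (Fin 3) → EuclideanSpace ℝ (Fin 3)}
    {p : ℝ → EuclideanSpace ℝ (Fin 3) → ℝ}
    (hsol : IsClassicalNSSolutionOn (Ico 0 T) ν 0 u p) (hLH : IsLerayHopfOn T ν 0 (u 0) u)
    (hdec : HasRapidSpatialDecay (u 0)) :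
    ∃ w : EuclideanSpace ℝ (Fin 3) → EuclideanSpace ℝ (Fin 3),
      (∀ y ∈ {x : EuclideanSpace ℝ (Fin 3) | IsBackwardSingularPoint u (T, x)}ᶜ,
        Tendsto (fun t => u t y) (𝓝[<] T) (𝓝 (w y))) ∧
      ContDiffOn ℝ ∞ w {x : EuclideanSpace ℝ (Fin 3) | IsBackwardSingularPoint u (T, x)}ᶜ ∧
      TendstoLocallyUniformlyOn u w (𝓝[<] T)
        {x : EuclideanSpace ℝ (Fin 3) | IsBackwardSingularPoint u (T, x)}ᶜ ∧
      TendstoLocallyUniformlyOn (fun t => fderiv ℝ (u t)) (fderiv ℝ w) (𝓝[<] T)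
        {x : EuclideanSpace ℝ (Fin 3) | IsBackwardSingularPoint u (T, x)}ᶜ ∧
      ∀ y ∈ {x : EuclideanSpace ℝ (Fin 3) | IsBackwardSingularPoint u (T, x)}ᶜ,
        VectorCalculus.divergence w y = 0 := by
  refine terminalField_on_compl_backwardSingularSlice u T (fun x₀ hx₀ => ?_) ?_
  · obtain ⟨r, hr, hrT, hH⟩ := regularPoint_iteratedFDeriv_bounds hν hT hsol hLH hdec hx₀
    refine ⟨r, hr, fun z hz => ?_, fun n => ?_⟩
    · simp only [mem_parabolicCylinder] at hz
      exact (hsol.contDiff_velocity ⟨by linarith [hz.1.1], hz.1.2⟩).contDiffAt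
    · obtain ⟨K, C, α, hα, hHn, -⟩ := hH n
      exact ⟨C, α, hα, hHn⟩
  · filter_upwards [Ioo_mem_nhdsLT hT] with t ht y
    exact hsol.divFree t ⟨ht.1.le, ht.2⟩ y

end Slice

end Summit.NavierStokesRegularity.NavierStokesRegularity.Theorems
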